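import Literature.Computability.Cryptography.CsidhActionProofs
import Literature.Computability.Cryptography.CsidhActionMontgomeryProofs
import Literature.Computability.Cryptography.CsidhActionIsomorphismProofs
import HarnessLib

/-!
# The CSIDH class-group action: the act-result is unique (CSIDH Lemma 6 + Prop. 8)

Sibling *proofs* file (theorems only, D-0014/D-0026) of
`Literature.Computability.Cryptography.CsidhAction`, assembling the three previous proof files
into the **uniqueness half of clause (1)** of the named fact `csidh_classGroupAction`
(Castryck–Lange–Martindale–Panny–Renes, *CSIDH*, ASIACRYPT 2018, §3 Lemma 6 with §5 Prop. 8):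
for `p ≡ 3 (mod 8)`, a label `f` and a valid coefficient `A`, any two act-results `A₁, A₂` of
`f` on `A` coincide — two `𝔽_p`-isogenies out of `E_A` with kernel `E_A[𝔞_f]` to valid
Montgomery curves have `𝔽_p`-isomorphic codomains (`exists_isogeny_deg_eq_one_of_isActResult`,
Lemma 6), an `𝔽_p`-isogeny of degree one is an admissible change of variables over `𝔽_p`
(`exists_variableChange_of_deg_eq_one`, *AEC* Prop. III.3.1(b)), and valid Montgomery
coefficients are rigid under such changes (`eq_of_variableChange_of_isCoeff`, Prop. 8). Hence
clause (1) of the fact reduces to the existence of a valid Montgomery model of `E_A/E_A[𝔞_f]`.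

## References

* [CastryckEtAl2018] W. Castryck, T. Lange, C. Martindale, L. Panny, J. Renes, *CSIDH*,
  ASIACRYPT 2018, LNCS 11274, §3 Lemma 6, §5 Prop. 8.
* [SilvermanAEC2009] J. H. Silverman, *The Arithmetic of Elliptic Curves*, 2nd ed.,
  Prop. III.3.1(b).
-/

noncomputable section

open scoped Classical

namespace Literature.Computability.Cryptography.Csidh

open Literature.NumberTheory.QuadraticFields.Quadratic
open Literature.NumberTheory.QuadraticFields.Quadratic.BinQF
open WeierstrassCurve

variable {p : ℕ} [Fact p.Prime]

/-- **CSIDH Lemma 6 with Prop. 8: the act-result is unique.** For `p ≡ 3 (mod 8)`, a label `f`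
of discriminant `-4p` and a valid coefficient `A`, if `A₁` and `A₂` are both valid coefficients
reached from `E_A` by `𝔽_p`-isogenies with kernel `E_A[𝔞_f]`, then `A₁ = A₂`.
[cite: CastryckEtAl2018, §3 Lemma 6 and §5 Prop. 8] -/
theorem eq_of_isActResult (hp8 : p % 8 = 3) {f : BinQF} (hf : IsLabel (-(p : ℤ)) f)
    {A A₁ A₂ : ZMod p} (hA : IsCoeff p A) (h₁ : IsActResult p f A A₁) (h₂ : IsActResult p f A A₂) :
    A₁ = A₂ := by
  obtain ⟨hE₁, hE₂, mu, hmu⟩ := exists_isogeny_deg_eq_one_of_isActResult hp8 hf hA h₁ h₂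
  haveI := hE₁
  haveI := hE₂
  haveI : PerfectField (ZMod p) := PerfectField.ofFinite
  obtain ⟨C, hC⟩ := exists_variableChange_of_deg_eq_one mu hmu
  exact (eq_of_variableChange_of_isCoeff hp8 h₂.1 C hC).symm

/-- **Clause (1) of `csidh_classGroupAction` from existence alone**: if some valid `A'` is
reached from `E_A` by an `𝔽_p`-isogeny with kernel `E_A[𝔞_f]`, it is the unique such `A'`.
[cite: CastryckEtAl2018, §3 Lemma 6 and Thm. 7, §5 Prop. 8] -/
theorem existsUnique_isActResult_of_exists (hp8 : p % 8 = 3) {f : BinQF} (hf : IsLabel (-(p : ℤ)) f)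
    {A : ZMod p} (hA : IsCoeff p A) (h : ∃ A' : ZMod p, IsActResult p f A A') :
    ∃! A' : ZMod p, IsActResult p f A A' := by
  obtain ⟨A', hA'⟩ := h
  exact ⟨A', hA', fun A'' hA'' ↦ eq_of_isActResult hp8 hf hA hA'' hA'⟩

/-- In particular `act p f A` is then the act-result. [folklore] -/
theorem isActResult_act_of_exists (hp8 : p % 8 = 3) {f : BinQF} (hf : IsLabel (-(p : ℤ)) f)
    {A : ZMod p} (hA : IsCoeff p A) (h : ∃ A' : ZMod p, IsActResult p f A A') :
    IsActResult p f A (act p f A) :=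
  isActResult_act (existsUnique_isActResult_of_exists hp8 hf hA h)

end Literature.Computability.Cryptography.Csidh
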